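import Summits.KontsevichZagierPeriods.KontsevichZagierPeriods.Theses.TerasomaMultiplication
import Literature.NumberTheory.Transcendental.KZHomotopyMoves
import Literature.NumberTheory.Transcendental.SemialgebraicRpow
import Literature.NumberTheory.Transcendental.SemialgebraicLineDeriv
import Literature.NumberTheory.Transcendental.KZLogCalculusProofs

/-!
# `MultiplicationAccessible` (stmt-KontsevichZagierPeriods-12305), line `shifted-family-prime-sieve`:
the `v`-direction Newton–Leibniz move of the corner Stokes in general dimension `p = n + 2`

The shifted Gauss multiplication is proved by Stokes on `W = U × (0,1)_v ⊆ ℝ^(p+1)`, `U` the corner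
blow-up chart domain of the cube (`t_k = 1 − yΘ_k`, `u = (θ₁, …, θ_{n+1}, y)`, `Θ₀ = 1 − Σθ_i`,
`Θ_{i+1} = θ_i`).  The `v`-component of the closed `p`-form is elementary in `v`: ONE rule-3 move in
`v` (band `[0,1]` over `U`, primitive `v^(px)·((1−vζ)/(1−ζ))^(ps−1)·GD(u)`, `ζ = (∏ t_k)^(1/p)`,
`GD` the graph density, `|GD| ≤ C(1−ζ)^(ps−1)`) gives `[W, ∂_v(…)] ∼ [U, GD]` (`cornerVGen`; the case
`p = 3` is `cornerStokesV`).  References: Kontsevich–Zagier 2001 §1.2 rule (3).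
-/

noncomputable section

open MeasureTheory Set Real
open scoped BigOperators
open Literature.NumberTheory.Transcendental
open Literature.NumberTheory.Transcendental.KZ
open Literature.ModelTheory.ExponentialFields (IsSemialgebraic isSemialgebraic_setOf_eval_pos
  isSemialgebraic_setOf_eval_lt)
open MvPolynomial (aeval X C)

namespace Summit.KontsevichZagierPeriods.TerasomaMultiplication.MultiplicationAccessible

namespace CornerVGen

variable {n : ℕ}

/-- On the chart domain `U` every box coordinate `t_k = 1 − yΘ_k` lies in `(0,1)` (the weights `Θ_k`
are positive and `y·Θ_k < 1`), so `∏ t_k > 0` and the geometric mean `ζ = (∏ t_k)^(1/p)` lies in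
`(0,1)`. [folklore] -/
theorem zeta_mem {Θ T : (Fin (n + 2) → ℝ) → Fin (n + 2) → ℝ} {Z : (Fin (n + 2) → ℝ) → ℝ}
    (hΘ0 : ∀ u, Θ u 0 = 1 - ∑ i : Fin (n + 1), u (Fin.castSucc i))
    (hΘs : ∀ u (i : Fin (n + 1)), Θ u i.succ = u (Fin.castSucc i))
    (hT : ∀ u k, T u k = 1 - u (Fin.last (n + 1)) * Θ u k)
    (hZ : ∀ u, Z u = (∏ k, T u k) ^ (1 / ((n:ℝ) + 2))) {u : Fin (n + 2) → ℝ}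
    (hu : u ∈ {u : Fin (n + 2) → ℝ | (∀ i : Fin (n + 1), 0 < u (Fin.castSucc i)) ∧ ∑ i : Fin (n + 1), u (Fin.castSucc i) < 1 ∧ 0 < u (Fin.last (n + 1)) ∧ u (Fin.last (n + 1)) * (1 - ∑ i : Fin (n + 1), u (Fin.castSucc i)) < 1 ∧ ∀ i : Fin (n + 1), u (Fin.last (n + 1)) * u (Fin.castSucc i) < 1}) :
    0 < ∏ k, T u k ∧ 0 < Z u ∧ Z u < 1 := by
  obtain ⟨hpos, hsum, hy, h0, hi⟩ := hu
  have hTk : ∀ k, 0 < T u k ∧ T u k < 1 := by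
    intro k
    have hk : 0 < Θ u k ∧ u (Fin.last (n + 1)) * Θ u k < 1 := by
      refine Fin.cases ?_ (fun i => ?_) k
      · rw [hΘ0]; exact ⟨by linarith, h0⟩
      · rw [hΘs]; exact ⟨hpos i, hi i⟩
    have := mul_pos hy hk.1
    rw [hT]
    constructor <;> linarith
  have hp : 0 < ∏ k, T u k := Finset.prod_pos fun k _ => (hTk k).1
  have hl : ∏ k, T u k < 1 := by
    rw [Fin.prod_univ_succ]
    calc T u 0 * ∏ i : Fin (n + 1), T u i.succ ≤ T u 0 * 1 :=
          mul_le_mul_of_nonneg_left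
            (Finset.prod_le_one (fun i _ => (hTk _).1.le) fun i _ => (hTk _).2.le) (hTk 0).1.le
      _ < 1 := by rw [mul_one]; exact (hTk 0).2
  rw [hZ]
  exact ⟨hp, rpow_pos_of_pos hp _, rpow_lt_one hp.le hl (by positivity)⟩

/-- The chart domain `U` is `ℚ`-semialgebraic (finite intersection of polynomial strict
inequalities). [folklore] -/
theorem isSemialgebraic_U (n : ℕ) :
    IsSemialgebraic ℚ {u : Fin (n + 2) → ℝ | (∀ i : Fin (n + 1), 0 < u (Fin.castSucc i)) ∧ ∑ i : Fin (n + 1), u (Fin.castSucc i) < 1 ∧ 0 < u (Fin.last (n + 1)) ∧ u (Fin.last (n + 1)) * (1 - ∑ i : Fin (n + 1), u (Fin.castSucc i)) < 1 ∧ ∀ i : Fin (n + 1), u (Fin.last (n + 1)) * u (Fin.castSucc i) < 1} := by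
  have hA := IsSemialgebraic.biInter Finset.univ _ fun (i : Fin (n + 1)) _ =>
    isSemialgebraic_setOf_eval_pos (k := ℚ) (R := ℝ) (X (Fin.castSucc i) : MvPolynomial (Fin (n + 2)) ℚ)
  have hB := isSemialgebraic_setOf_eval_lt (k := ℚ) (R := ℝ)
    (∑ i : Fin (n + 1), X (Fin.castSucc i) : MvPolynomial (Fin (n + 2)) ℚ) 1
  have hC := isSemialgebraic_setOf_eval_pos (k := ℚ) (R := ℝ)
    (X (Fin.last (n + 1)) : MvPolynomial (Fin (n + 2)) ℚ)
  have hD := isSemialgebraic_setOf_eval_lt (k := ℚ) (R := ℝ)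
    (X (Fin.last (n + 1)) * (1 - ∑ i : Fin (n + 1), X (Fin.castSucc i)) :
      MvPolynomial (Fin (n + 2)) ℚ) 1
  have hE := IsSemialgebraic.biInter Finset.univ _ fun (i : Fin (n + 1)) _ =>
    isSemialgebraic_setOf_eval_lt (k := ℚ) (R := ℝ)
      (X (Fin.last (n + 1)) * X (Fin.castSucc i) : MvPolynomial (Fin (n + 2)) ℚ) 1
  convert (((hA.inter hB).inter hC).inter hD).inter hE using 1
  ext u
  simp only [map_sum, map_sub, map_mul, map_one, MvPolynomial.aeval_X, mem_setOf_eq, mem_inter_iff,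
    mem_iInter, Finset.mem_univ, iInter_true]
  tauto

/-- The chart domain lies in the box `[0, p]^(n+2)`: `θ_i < 1`, and `y = y·Θ₀ + Σ_i y·θ_i < 1 + (n+1)`.
[folklore] -/
theorem U_subset_Icc {u : Fin (n + 2) → ℝ}
    (hu : u ∈ {u : Fin (n + 2) → ℝ | (∀ i : Fin (n + 1), 0 < u (Fin.castSucc i)) ∧ ∑ i : Fin (n + 1), u (Fin.castSucc i) < 1 ∧ 0 < u (Fin.last (n + 1)) ∧ u (Fin.last (n + 1)) * (1 - ∑ i : Fin (n + 1), u (Fin.castSucc i)) < 1 ∧ ∀ i : Fin (n + 1), u (Fin.last (n + 1)) * u (Fin.castSucc i) < 1}) :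
    u ∈ Set.Icc (0 : Fin (n + 2) → ℝ) (fun _ => (n:ℝ) + 2) := by
  obtain ⟨hpos, hsum, hy, h0, hi⟩ := hu
  have h1 : ∑ i : Fin (n + 1), u (Fin.last (n + 1)) * u (Fin.castSucc i) <
      ∑ _i : Fin (n + 1), (1:ℝ) :=
    Finset.sum_lt_sum_of_nonempty Finset.univ_nonempty fun i _ => hi i
  rw [← Finset.mul_sum] at h1
  simp only [Finset.sum_const, Finset.card_univ, Fintype.card_fin, nsmul_eq_mul, mul_one] at h1
  push_cast at h1
  have h2 : u (Fin.last (n + 1)) * (1 - ∑ i : Fin (n + 1), u (Fin.castSucc i)) =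
      u (Fin.last (n + 1)) - u (Fin.last (n + 1)) * ∑ i : Fin (n + 1), u (Fin.castSucc i) := by
    ring
  have hn : (0:ℝ) ≤ n := n.cast_nonneg
  refine ⟨fun k => Fin.lastCases hy.le (fun i => (hpos i).le) k,
    fun k => Fin.lastCases ?_ (fun i => ?_) k⟩
  · show u (Fin.last (n + 1)) ≤ (n:ℝ) + 2
    linarith
  · have : u (Fin.castSucc i) ≤ ∑ j : Fin (n + 1), u (Fin.castSucc j) :=
      Finset.single_le_sum (f := fun j => u (Fin.castSucc j)) (fun j _ => (hpos j).le)
        (Finset.mem_univ i)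
    show u (Fin.castSucc i) ≤ (n:ℝ) + 2
    linarith

/-- The band `U × [0,1]` of the `v`-move has finite volume (it lies in a bounded box). [folklore] -/
theorem volume_band_lt_top (n : ℕ) :
    volume (KZlog.band {u : Fin (n + 2) → ℝ | (∀ i : Fin (n + 1), 0 < u (Fin.castSucc i)) ∧ ∑ i : Fin (n + 1), u (Fin.castSucc i) < 1 ∧ 0 < u (Fin.last (n + 1)) ∧ u (Fin.last (n + 1)) * (1 - ∑ i : Fin (n + 1), u (Fin.castSucc i)) < 1 ∧ ∀ i : Fin (n + 1), u (Fin.last (n + 1)) * u (Fin.castSucc i) < 1} (fun _ => 0) (fun _ => 1)) < ⊤ := by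
  refine lt_of_le_of_lt (measure_mono (fun w hw => ?_))
    (measure_Icc_lt_top (a := (0 : Fin (n + 3) → ℝ)) (b := fun _ => (n:ℝ) + 2))
  obtain ⟨hu, h0, h1⟩ := hw
  have hb := U_subset_Icc hu
  have hn : (0:ℝ) ≤ n := n.cast_nonneg
  refine ⟨fun k => Fin.lastCases (by simpa using h0) (fun j => hb.1 j) k,
    fun k => Fin.lastCases ?_ (fun j => hb.2 j) k⟩
  have h1' : w (Fin.last (n + 2)) ≤ 1 := h1
  show w (Fin.last (n + 2)) ≤ (n:ℝ) + 2
  linarith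

/-- `ζ ∘ init` (the geometric mean of the box coordinates `t_k = 1 − y·Θ_k`, polynomials in `w`, read
on the band) is `ℚ`-semialgebraic on any `ℚ`-semialgebraic set on which `∏ t_k > 0`. [folklore] -/
theorem isSemialgebraicFunOn_zeta_init {S : Set (Fin (n + 3) → ℝ)} (hS : IsSemialgebraic ℚ S)
    {Θ T : (Fin (n + 2) → ℝ) → Fin (n + 2) → ℝ} {Z : (Fin (n + 2) → ℝ) → ℝ}
    (hΘ0 : ∀ u, Θ u 0 = 1 - ∑ i : Fin (n + 1), u (Fin.castSucc i))
    (hΘs : ∀ u (i : Fin (n + 1)), Θ u i.succ = u (Fin.castSucc i))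
    (hT : ∀ u k, T u k = 1 - u (Fin.last (n + 1)) * Θ u k)
    (hZ : ∀ u, Z u = (∏ k, T u k) ^ (1 / ((n:ℝ) + 2)))
    (hpos : ∀ w ∈ S, 0 < ∏ k, T (Fin.init w) k) :
    IsSemialgebraicFunOn ℚ S (fun w => Z (Fin.init w)) := by
  have h1 : IsSemialgebraicFunOn ℚ S (fun _ : Fin (n + 3) → ℝ => (1:ℝ)) :=
    isSemialgebraicFunOn_const_of_isAlgebraic hS isAlgebraic_one
  have hΘ : ∀ k, IsSemialgebraicFunOn ℚ S (fun w => Θ (Fin.init w) k) := by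
    refine Fin.cases ?_ (fun i => ?_)
    · have hsum := IsSemialgebraicFunOn.fun_finsetSum Finset.univ hS
        (F := fun (i : Fin (n + 1)) (w : Fin (n + 3) → ℝ) => w (Fin.castSucc (Fin.castSucc i)))
        fun i _ => isSemialgebraicFunOn_apply hS _
      exact (h1.fun_sub hsum).congr fun w _ => by rw [hΘ0]; rfl
    · exact (isSemialgebraicFunOn_apply hS (Fin.castSucc (Fin.castSucc i))).congr fun w _ => by
        rw [hΘs]; rfl
  have hTk : ∀ k, IsSemialgebraicFunOn ℚ S (fun w => T (Fin.init w) k) := fun k =>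
    (h1.fun_sub ((isSemialgebraicFunOn_apply hS (Fin.castSucc (Fin.last (n + 1)))).fun_mul
      (hΘ k))).congr fun w _ => by rw [hT]; rfl
  have hP : IsSemialgebraicFunOn ℚ S (fun w => ∏ k, T (Fin.init w) k) :=
    IsSemialgebraicFunOn.fun_finsetProd Finset.univ hS fun k _ => hTk k
  refine (hP.rpow_ratCast hS hpos (1 / ((n:ℚ) + 2))).congr fun w _ => ?_
  rw [hZ]
  push_cast
  ring_nf

/-- The elementary estimate behind the integrability of the `v`-derivative: for `v ∈ [0,1]`,
`z ∈ (0,1)`, `a = a' + 1 ≥ 1`, `e = e' + 1 ≥ 1` and `|g| ≤ C(1−z)^e`, with `ρ = (1−vz)/(1−z)`,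
`|(a v^a' ρ^e − e v^a z ρ^e'/(1−z))·g| ≤ (a + e)·C` (since `ρ(1−z) = 1 − vz ≤ 1`). [folklore] -/
theorem deriv_bound {a a' e e' v z C g : ℝ} (ha : a' + 1 = a) (he : e' + 1 = e) (ha' : 0 ≤ a')
    (he' : 0 ≤ e') (hv0 : 0 ≤ v) (hv1 : v ≤ 1) (hz0 : 0 < z) (hz1 : z < 1)
    (hg : |g| ≤ C * (1 - z) ^ e) :
    |(a * v ^ a' * ((1 - v * z) / (1 - z)) ^ e -
        e * v ^ a * z * ((1 - v * z) / (1 - z)) ^ e' / (1 - z)) * g| ≤ (a + e) * C := by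
  have h1z : 0 < 1 - z := by linarith
  have hvz0 : 0 ≤ 1 - v * z := by nlinarith
  have hvz1 : 1 - v * z ≤ 1 := by nlinarith
  have ha0 : 0 ≤ a := by linarith
  have he0 : 0 ≤ e := by linarith
  set ρ := (1 - v * z) / (1 - z) with hρ
  have hρ0 : 0 ≤ ρ := div_nonneg hvz0 h1z.le
  have hρeq : ρ * (1 - z) = 1 - v * z := div_mul_cancel₀ _ h1z.ne'
  -- the two elementary estimates
  have e1 : v ^ a' * ρ ^ e * (1 - z) ^ e ≤ 1 := by
    rw [mul_assoc, ← Real.mul_rpow hρ0 h1z.le, hρeq]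
    exact mul_le_one₀ (Real.rpow_le_one hv0 hv1 ha') (Real.rpow_nonneg hvz0 _)
      (Real.rpow_le_one hvz0 hvz1 he0)
  have e2 : v ^ a * z * ρ ^ e' / (1 - z) * (1 - z) ^ e ≤ 1 := by
    have hBT : v ^ a * z * ρ ^ e' / (1 - z) * (1 - z) ^ e = v ^ a * z * (ρ * (1 - z)) ^ e' := by
      rw [Real.mul_rpow hρ0 h1z.le, ← he, Real.rpow_add_one h1z.ne']
      field_simp
    rw [hBT, hρeq]
    exact mul_le_one₀ (mul_le_one₀ (Real.rpow_le_one hv0 hv1 ha0) hz0.le hz1.le)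
      (Real.rpow_nonneg hvz0 _) (Real.rpow_le_one hvz0 hvz1 he')
  have hpz : 0 < (1 - z) ^ e := Real.rpow_pos_of_pos h1z _
  have hC : 0 ≤ C := by
    by_contra hneg
    have := mul_neg_of_neg_of_pos (not_le.mp hneg) hpz
    linarith [(abs_nonneg _).trans hg]
  have hA0 : 0 ≤ v ^ a' * ρ ^ e := by positivity
  have hB0 : 0 ≤ v ^ a * z * ρ ^ e' / (1 - z) := by positivity
  rw [abs_mul]
  calc |a * v ^ a' * ρ ^ e - e * v ^ a * z * ρ ^ e' / (1 - z)| * |g|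
      ≤ (a * (v ^ a' * ρ ^ e) + e * (v ^ a * z * ρ ^ e' / (1 - z))) * (C * (1 - z) ^ e) := by
        refine mul_le_mul ((abs_sub _ _).trans (le_of_eq ?_)) hg (abs_nonneg _) (by positivity)
        rw [abs_of_nonneg (by positivity), abs_of_nonneg (by positivity)]
        ring
    _ = a * C * (v ^ a' * ρ ^ e * (1 - z) ^ e) +
        e * C * (v ^ a * z * ρ ^ e' / (1 - z) * (1 - z) ^ e) := by ring
    _ ≤ a * C * 1 + e * C * 1 := by gcongr
    _ = (a + e) * C := by ring

end CornerVGen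

/-- **The `v`-direction Newton–Leibniz move of the corner Stokes in general dimension `p = n + 2`**
(registered sub-goal `cornerVGen`). For `x, s ≥ 1`, a function `GD` bounded on the chart domain `U` by
`C(1−ζ)^(ps−1)` (`ζ = Z u` the geometric mean of the box coordinates `t_k = 1 − yΘ_k`) and a
representation `rU` pinned as `[U, GD]`, the band representation
`[U × (0,1), ∂_v(v^(px)((1−vζ)/(1−ζ))^(ps−1)·GD)]` exists and is equivalent to `rU`: ONE rule-3 move
with the primitive `v^(px)((1−vζ)/(1−ζ))^(ps−1)GD(u)` (vanishing at `v = 0`, equal to `GD` at `v = 1`),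
then opening the fibres. [cite: KontsevichZagier2001, §1.2 rule (3)] -/
theorem cornerVGen : ∀ (n : ℕ) (x s : ℚ), 1 ≤ x → 1 ≤ s → ∀ (Θ T : (Fin (n + 2) → ℝ) → Fin (n + 2) → ℝ) (Z GD : (Fin (n + 2) → ℝ) → ℝ) (C : ℝ),
    (∀ u, Θ u 0 = 1 - ∑ i : Fin (n + 1), u (Fin.castSucc i)) → (∀ u (i : Fin (n + 1)), Θ u i.succ = u (Fin.castSucc i)) →
    (∀ u k, T u k = 1 - u (Fin.last (n + 1)) * Θ u k) →
    (∀ u, Z u = (∏ k, T u k) ^ (1 / ((n:ℝ) + 2))) →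
    (∀ u ∈ {u : Fin (n + 2) → ℝ | (∀ i : Fin (n + 1), 0 < u (Fin.castSucc i)) ∧ ∑ i : Fin (n + 1), u (Fin.castSucc i) < 1 ∧ 0 < u (Fin.last (n + 1)) ∧ u (Fin.last (n + 1)) * (1 - ∑ i : Fin (n + 1), u (Fin.castSucc i)) < 1 ∧ ∀ i : Fin (n + 1), u (Fin.last (n + 1)) * u (Fin.castSucc i) < 1}, |GD u| ≤ C * (1 - Z u) ^ (((n:ℝ) + 2) * (s:ℝ) - 1)) →
    ∀ (rU : KZ.IntegralRep (n + 2)), rU.domain = {u : Fin (n + 2) → ℝ | (∀ i : Fin (n + 1), 0 < u (Fin.castSucc i)) ∧ ∑ i : Fin (n + 1), u (Fin.castSucc i) < 1 ∧ 0 < u (Fin.last (n + 1)) ∧ u (Fin.last (n + 1)) * (1 - ∑ i : Fin (n + 1), u (Fin.castSucc i)) < 1 ∧ ∀ i : Fin (n + 1), u (Fin.last (n + 1)) * u (Fin.castSucc i) < 1} → Set.EqOn rU.integrand GD rU.domain →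
    ∃ N : KZ.IntegralRep (n + 3), N.domain = {w : Fin (n + 3) → ℝ | (Fin.init w : Fin (n + 2) → ℝ) ∈ {u : Fin (n + 2) → ℝ | (∀ i : Fin (n + 1), 0 < u (Fin.castSucc i)) ∧ ∑ i : Fin (n + 1), u (Fin.castSucc i) < 1 ∧ 0 < u (Fin.last (n + 1)) ∧ u (Fin.last (n + 1)) * (1 - ∑ i : Fin (n + 1), u (Fin.castSucc i)) < 1 ∧ ∀ i : Fin (n + 1), u (Fin.last (n + 1)) * u (Fin.castSucc i) < 1} ∧ 0 < w (Fin.last (n + 2)) ∧ w (Fin.last (n + 2)) < 1} ∧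
      (N.integrand = fun w => (((n:ℝ) + 2) * (x:ℝ) * (w (Fin.last (n + 2))) ^ (((n:ℝ) + 2) * (x:ℝ) - 1) *
          ((1 - w (Fin.last (n + 2)) * Z (Fin.init w)) / (1 - Z (Fin.init w))) ^ (((n:ℝ) + 2) * (s:ℝ) - 1) -
        (((n:ℝ) + 2) * (s:ℝ) - 1) * (w (Fin.last (n + 2))) ^ (((n:ℝ) + 2) * (x:ℝ)) * Z (Fin.init w) *
          ((1 - w (Fin.last (n + 2)) * Z (Fin.init w)) / (1 - Z (Fin.init w))) ^ (((n:ℝ) + 2) * (s:ℝ) - 2) / (1 - Z (Fin.init w))) *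
        GD (Fin.init w)) ∧
      KZ.Equivalent N rU := by
  intro n x s hx hs Θ T Z GD C hΘ0 hΘs hT hZ hGD rU hrU hrUi
  -- the chart domain, the band, positivity facts
  set U : Set (Fin (n + 2) → ℝ) := {u : Fin (n + 2) → ℝ | (∀ i : Fin (n + 1), 0 < u (Fin.castSucc i)) ∧ ∑ i : Fin (n + 1), u (Fin.castSucc i) < 1 ∧ 0 < u (Fin.last (n + 1)) ∧ u (Fin.last (n + 1)) * (1 - ∑ i : Fin (n + 1), u (Fin.castSucc i)) < 1 ∧ ∀ i : Fin (n + 1), u (Fin.last (n + 1)) * u (Fin.castSucc i) < 1} with hUdef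
  have hUsa : IsSemialgebraic ℚ U := CornerVGen.isSemialgebraic_U n
  have hZU : ∀ u ∈ U, 0 < Z u ∧ Z u < 1 := fun u hu => (CornerVGen.zeta_mem hΘ0 hΘs hT hZ hu).2
  have hx1R : (1:ℝ) ≤ x := by exact_mod_cast hx
  have hs1R : (1:ℝ) ≤ s := by exact_mod_cast hs
  have hnx : (0:ℝ) ≤ (n:ℝ) * x := mul_nonneg n.cast_nonneg (by linarith)
  have hns : (0:ℝ) ≤ (n:ℝ) * s := mul_nonneg n.cast_nonneg (by linarith)
  have hxR : (1:ℝ) ≤ ((n:ℝ) + 2) * (x:ℝ) - 1 := by linarith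
  have hsR : (0:ℝ) ≤ ((n:ℝ) + 2) * (s:ℝ) - 2 := by linarith
  have ha : IsSemialgebraicFunOn ℚ U (fun _ : Fin (n + 2) → ℝ => (0:ℝ)) := by
    simpa using isSemialgebraicFunOn_ratCast hUsa 0
  have hb : IsSemialgebraicFunOn ℚ U (fun _ : Fin (n + 2) → ℝ => (1:ℝ)) := by
    simpa using isSemialgebraicFunOn_ratCast hUsa 1
  set B : Set (Fin (n + 3) → ℝ) := KZlog.band U (fun _ => 0) (fun _ => 1) with hBdef
  have hBsa : IsSemialgebraic ℚ B := KZlog.isSemialgebraic_band ha hb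
  have hBmeas : MeasurableSet B :=
    Literature.ModelTheory.ExponentialFields.IsSemialgebraic.measurableSet_holds hBsa
  have hmemB : ∀ {w : Fin (n + 3) → ℝ}, w ∈ B →
      (Fin.init w : Fin (n + 2) → ℝ) ∈ U ∧ 0 ≤ w (Fin.last (n + 2)) ∧ w (Fin.last (n + 2)) ≤ 1 :=
    fun hw => hw
  -- the primitive `F` and its `v`-derivative `f`
  set F : (Fin (n + 3) → ℝ) → ℝ := fun w => (w (Fin.last (n + 2))) ^ (((n:ℝ) + 2) * (x:ℝ)) *
    ((1 - w (Fin.last (n + 2)) * Z (Fin.init w)) / (1 - Z (Fin.init w))) ^ (((n:ℝ) + 2) * (s:ℝ) - 1) *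
    GD (Fin.init w) with hFdef
  set f : (Fin (n + 3) → ℝ) → ℝ := fun w => (((n:ℝ) + 2) * (x:ℝ) *
      (w (Fin.last (n + 2))) ^ (((n:ℝ) + 2) * (x:ℝ) - 1) *
      ((1 - w (Fin.last (n + 2)) * Z (Fin.init w)) / (1 - Z (Fin.init w))) ^ (((n:ℝ) + 2) * (s:ℝ) - 1) -
    (((n:ℝ) + 2) * (s:ℝ) - 1) * (w (Fin.last (n + 2))) ^ (((n:ℝ) + 2) * (x:ℝ)) * Z (Fin.init w) *
      ((1 - w (Fin.last (n + 2)) * Z (Fin.init w)) / (1 - Z (Fin.init w))) ^ (((n:ℝ) + 2) * (s:ℝ) - 2) /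
        (1 - Z (Fin.init w))) *
    GD (Fin.init w) with hfdef
  -- positivity on the band
  have hρpos : ∀ {w : Fin (n + 3) → ℝ}, w ∈ B → 0 < 1 - Z (Fin.init w) ∧
      0 < (1 - w (Fin.last (n + 2)) * Z (Fin.init w)) / (1 - Z (Fin.init w)) := by
    intro w hw
    obtain ⟨hu, h0, h1⟩ := hmemB hw
    obtain ⟨hz0, hz1⟩ := hZU _ hu
    have hnum : 0 < 1 - w (Fin.last (n + 2)) * Z (Fin.init w) := by nlinarith
    exact ⟨by linarith, div_pos hnum (by linarith)⟩
  -- semialgebraicity of the pieces on the band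
  have hv : IsSemialgebraicFunOn ℚ B (fun w : Fin (n + 3) → ℝ => w (Fin.last (n + 2))) :=
    isSemialgebraicFunOn_apply hBsa _
  have hZB : IsSemialgebraicFunOn ℚ B (fun w => Z (Fin.init w)) :=
    CornerVGen.isSemialgebraicFunOn_zeta_init hBsa hΘ0 hΘs hT hZ
      fun w hw => (CornerVGen.zeta_mem hΘ0 hΘs hT hZ (hmemB hw).1).1
  have h1B : IsSemialgebraicFunOn ℚ B (fun _ : Fin (n + 3) → ℝ => (1:ℝ)) :=
    isSemialgebraicFunOn_const_of_isAlgebraic hBsa isAlgebraic_one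
  have hρB : IsSemialgebraicFunOn ℚ B
      (fun w => (1 - w (Fin.last (n + 2)) * Z (Fin.init w)) / (1 - Z (Fin.init w))) :=
    (h1B.fun_sub (hv.fun_mul hZB)).div (h1B.fun_sub hZB) fun w hw => (hρpos hw).1.ne'
  have hGU : IsSemialgebraicFunOn ℚ U GD := by
    have h := rU.isSemialgebraicFunOn_integrand
    rw [hrU] at h
    exact h.congr fun u hu => hrUi (by rw [hrU]; exact hu)
  have hinit : IsSemialgebraicMapOn ℚ B (fun w : Fin (n + 3) → ℝ => (Fin.init w : Fin (n + 2) → ℝ)) :=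
    IsSemialgebraicMapOn.of_forall hBsa fun j =>
      (isSemialgebraicFunOn_apply hBsa (Fin.castSucc j)).congr fun w _ => rfl
  have hGDB : IsSemialgebraicFunOn ℚ B (fun w => GD (Fin.init w)) :=
    (IsSemialgebraicFunOn.comp_isSemialgebraicMapOn_holds hGU hinit fun w hw => (hmemB hw).1).congr
      fun w _ => rfl
  have hx0 : (((n:ℚ) + 2) * x : ℚ) ≠ 0 := by positivity
  have hx1 : (((n:ℚ) + 2) * x - 1 : ℚ) ≠ 0 :=
    ne_of_gt (by have : (0:ℚ) ≤ (n:ℚ) * x := mul_nonneg n.cast_nonneg (by linarith); linarith)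
  have hvpow : IsSemialgebraicFunOn ℚ B
      (fun w : Fin (n + 3) → ℝ => (w (Fin.last (n + 2))) ^ (((n:ℝ) + 2) * (x:ℝ))) :=
    (hv.rpow_ratCast_of_nonneg (fun w hw => (hmemB hw).2.1) hx0).congr fun w _ => by
      push_cast; ring_nf
  have hvpow' : IsSemialgebraicFunOn ℚ B
      (fun w : Fin (n + 3) → ℝ => (w (Fin.last (n + 2))) ^ (((n:ℝ) + 2) * (x:ℝ) - 1)) :=
    (hv.rpow_ratCast_of_nonneg (fun w hw => (hmemB hw).2.1) hx1).congr fun w _ => by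
      push_cast; ring_nf
  have hρpow : IsSemialgebraicFunOn ℚ B (fun w => ((1 - w (Fin.last (n + 2)) * Z (Fin.init w)) /
      (1 - Z (Fin.init w))) ^ (((n:ℝ) + 2) * (s:ℝ) - 1)) :=
    (hρB.rpow_ratCast hBsa (fun w hw => (hρpos hw).2) (((n:ℚ) + 2) * s - 1)).congr fun w _ => by
      push_cast; ring_nf
  have hρpow' : IsSemialgebraicFunOn ℚ B (fun w => ((1 - w (Fin.last (n + 2)) * Z (Fin.init w)) /
      (1 - Z (Fin.init w))) ^ (((n:ℝ) + 2) * (s:ℝ) - 2)) :=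
    (hρB.rpow_ratCast hBsa (fun w hw => (hρpos hw).2) (((n:ℚ) + 2) * s - 2)).congr fun w _ => by
      push_cast; ring_nf
  have hcx : IsSemialgebraicFunOn ℚ B (fun _ : Fin (n + 3) → ℝ => (((n:ℝ) + 2) * (x:ℝ))) :=
    (isSemialgebraicFunOn_ratCast hBsa (((n:ℚ) + 2) * x)).congr fun w _ => by push_cast; ring
  have hcs : IsSemialgebraicFunOn ℚ B (fun _ : Fin (n + 3) → ℝ => (((n:ℝ) + 2) * (s:ℝ) - 1)) :=
    (isSemialgebraicFunOn_ratCast hBsa (((n:ℚ) + 2) * s - 1)).congr fun w _ => by push_cast; ring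
  have hFsa : IsSemialgebraicFunOn ℚ B F := (hvpow.fun_mul hρpow).fun_mul hGDB
  have hfsa : IsSemialgebraicFunOn ℚ B f :=
    ((((hcx.fun_mul hvpow').fun_mul hρpow).fun_sub
      ((((hcs.fun_mul hvpow).fun_mul hZB).fun_mul hρpow').div (h1B.fun_sub hZB)
        fun w hw => (hρpos hw).1.ne'))).fun_mul hGDB
  -- evaluation of `F` on a fibre
  have hFsnoc : ∀ (u : Fin (n + 2) → ℝ) (t : ℝ), F (Fin.snoc u t) =
      t ^ (((n:ℝ) + 2) * (x:ℝ)) * ((1 - t * Z u) / (1 - Z u)) ^ (((n:ℝ) + 2) * (s:ℝ) - 1) * GD u := by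
    intro u t
    simp only [hFdef, Fin.snoc_last, Fin.init_snoc]
  -- the fibrewise derivative (on the closed fibre, `px ≥ 1`)
  have hder : ∀ u ∈ U, ∀ t ∈ Icc (0:ℝ) 1,
      HasDerivAt (fun t : ℝ => F (Fin.snoc u t)) (f (Fin.snoc u t)) t := by
    intro u hu t ht
    obtain ⟨hz0, hz1⟩ := hZU u hu
    obtain ⟨ht0, ht1⟩ := ht
    have h1z : (1 - Z u) ≠ 0 := by linarith
    have hρt : 0 < (1 - t * Z u) / (1 - Z u) := div_pos (by nlinarith) (by linarith)
    have h1 : HasDerivAt (fun t : ℝ => t ^ (((n:ℝ) + 2) * (x:ℝ)))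
        (((n:ℝ) + 2) * (x:ℝ) * t ^ (((n:ℝ) + 2) * (x:ℝ) - 1)) t := by
      simpa using (hasDerivAt_id t).rpow_const (p := ((n:ℝ) + 2) * (x:ℝ)) (Or.inr (by linarith))
    have h2 : HasDerivAt (fun t : ℝ => ((1 - t * Z u) / (1 - Z u)) ^ (((n:ℝ) + 2) * (s:ℝ) - 1))
        (-(1 * Z u) / (1 - Z u) * (((n:ℝ) + 2) * (s:ℝ) - 1) *
          ((1 - t * Z u) / (1 - Z u)) ^ (((n:ℝ) + 2) * (s:ℝ) - 1 - 1)) t :=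
      ((((hasDerivAt_id t).mul_const (Z u)).const_sub 1).div_const (1 - Z u)).rpow_const
        (Or.inl hρt.ne')
    rw [show ((n:ℝ) + 2) * s - 1 - 1 = ((n:ℝ) + 2) * s - 2 by ring] at h2
    have h := (h1.mul h2).mul_const (GD u)
    simp only [hFsnoc, hfdef, Fin.snoc_last, Fin.init_snoc]
    refine h.congr_deriv ?_
    field_simp
    ring
  have hcont : ∀ u ∈ U, ContinuousOn (fun t : ℝ => F (Fin.snoc u t)) (Icc (0:ℝ) 1) :=
    fun u hu t ht => (hder u hu t ht).continuousAt.continuousWithinAt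
  -- `|f| ≤ (px + ps − 1)·C` on the band, hence integrability
  have hint : IntegrableOn f B :=
    ⟨aestronglyMeasurable_of_isSemialgebraicFunOn hfsa hBmeas,
      HasFiniteIntegral.restrict_of_bounded (C := (((n:ℝ) + 2) * (x:ℝ) + (((n:ℝ) + 2) * (s:ℝ) - 1)) * C)
        (CornerVGen.volume_band_lt_top n) ((ae_restrict_mem hBmeas).mono fun w hw => by
          rw [Real.norm_eq_abs]
          exact CornerVGen.deriv_bound (by ring) (by ring) (by linarith) hsR (hmemB hw).2.1
            (hmemB hw).2.2 (hZU _ (hmemB hw).1).1 (hZU _ (hmemB hw).1).2 (hGD _ (hmemB hw).1))⟩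
  -- the boundary function is `GD` itself
  have hbdry : ∀ u ∈ U, F (Fin.snoc u 1) - F (Fin.snoc u 0) = GD u := by
    intro u hu
    obtain ⟨hz0, hz1⟩ := hZU u hu
    rw [hFsnoc, hFsnoc, Real.one_rpow, Real.zero_rpow (by linarith), one_mul,
      show (1 - 1 * Z u) / (1 - Z u) = 1 from by rw [one_mul]; exact div_self (by linarith),
      Real.one_rpow]
    ring
  have hds : IsSemialgebraicFunOn ℚ U (fun u => F (Fin.snoc u 1) - F (Fin.snoc u 0)) :=
    hGU.congr fun u hu => (hbdry u hu).symm
  have hdi : IntegrableOn (fun u => F (Fin.snoc u 1) - F (Fin.snoc u 0)) U := by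
    have h := rU.integrableOn
    rw [hrU] at h
    refine h.congr_fun (fun u hu => ?_)
      (Literature.ModelTheory.ExponentialFields.IsSemialgebraic.measurableSet_holds hUsa)
    rw [hrUi (by rw [hrU]; exact hu)]
    exact (hbdry u hu).symm
  obtain ⟨rb, rd, hrbd, hrbi, hrdd, hrdi, hrel⟩ :=
    KZ.exists_band_newtonLeibniz hUsa (fun _ => 0) (fun _ => 1) ha hb (fun _ _ => zero_le_one)
      F f hFsa hfsa hcont (fun u hu t ht => hder u hu t (Ioo_subset_Icc_self ht)) hint hds hdi
  -- open the fibres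
  obtain ⟨N, hNd, hNi, hNrel⟩ := KZ.of_sub_of_restrict_openBand_mem_relations ha hb rb hrbd
  refine ⟨N, ?_, ?_, ?_⟩
  · rw [hNd]
  · rw [hNi, hrbi]
  · -- `N ∼ rb ∼ rd = [U, GD] ∼ rU`
    have hdU : KZ.of rd - KZ.of rU ∈ KZ.relations := by
      refine KZ.of_sub_of_mem_relations_of_eqOn (by rw [hrU, hrdd]) ?_
      intro u hu
      rw [hrdd] at hu
      rw [hrdi, hrUi (by rw [hrU]; exact hu)]
      exact hbdry u hu
    show KZ.of N - KZ.of rU ∈ KZ.relations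
    convert KZ.relations.add_mem (KZ.relations.sub_mem hrel hNrel) hdU using 1
    abel

end Summit.KontsevichZagierPeriods.TerasomaMultiplication.MultiplicationAccessible

end
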